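import Mathlib
import Summits.Ventures.PercRepro2.TypedCountPendant

/-!
# The class counts with a general `v`-weight, and their pendant-block reduction
(blind cell PercRepro2, night-3 g27, 2026-08-29; `proofs/NIGHT3-CERT.md` §36.9)

The typed point-split count `T = Σ_ω [v ∈ R_ω]·(F R − F B)(G R − G B)` of `TypedCountDeletion`
weighs a colouring by `[v ∈ R]` (the red cluster of `s`).  Its CLASS versions weigh by a function
`W [v ∈ R] [v ∈ B]`: `W a b = [a]` gives `T` (the typed (PS1) count), `W a b = [a ≠ b]` the typed
(PS) count `S_D` (`v` in exactly one of the two clusters, §33.6), `W a b = [¬a ∧ ¬b]` the count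
`S_N`, `W a b = [a ∧ b]` the count `S_K`, `W = 1` the typed Harris sum.  Because the weight of a
colouring `ω₁ ⊔ ω₂` across a pendant block depends on `ω₁` only (`mem_cluster_join_pendant_iff`,
for the red and for the blue cluster), g26's pendant-block reduction holds verbatim for every
nonnegative `W`: `2^{|S₂|}·T_W(S₁; F̂, Ĝ) ≤ T_W(S₁ ⊔ S₂; F, G)` (`typedCountW_pendant_reduction`)
and `T_W(S₁; F̂, Ĝ) ≥ 0 ⟹ T_W(S₁ ⊔ S₂; F, G) ≥ 0` (`typedCountW_nonneg_of_pendant`).  So a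
minimal edge set with `S_D < 0` (or `S_N < 0`, …) has no pendant block — the census class of the
typed (PS) count is the class of `s–v` chains of 2-connected blocks, as for `T`.
Own work; standard axioms.
-/

namespace Summit.Ventures.PercRepro2

namespace TypedDeletion

variable {V : Type*} {E : Type*}

section DefsW

variable [Fintype E] [DecidableEq E] {R : Type*} [CommRing R]

open Classical in
/-- The class weight `W [v ∈ R] [v ∈ B]` of a colouring with red cluster `R` and blue cluster `B`. -/
noncomputable def wtW (W : Bool → Bool → R) (ends : E → Sym2 V) (s v : V) (ω ωb : Config E) : R :=
  W (decide (v ∈ cluster ends ω s)) (decide (v ∈ cluster ends ωb s))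

open Classical in
/-- The class count `T_W(S, C) = Σ_{ω ≤ 1_S} W [v ∈ R] [v ∈ B] · (F R − F B)(G R − G B)` with
`R = C_s(ω ∪ C)`, `B = C_s(ω̄ ∪ C)` (`ω̄` = the complement of `ω` on `S`); as in `typedCount`, the
weight is evaluated on the uncontracted `ω`, `ω̄` (the two coincide at `C = ∅`, the only case used). -/
noncomputable def typedCountW (W : Bool → Bool → R) (ends : E → Sym2 V) (s v : V)
    (F G : Set V → R) (S C : Finset E) : R :=
  ∑ ω : Config E, if OnS S ω then
    wtW W ends s v ω (flipOn S ω) *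
      dlt F G (cluster ends (withC C ω) s) (cluster ends (withC C (flipOn S ω)) s)
  else 0

/-- The (PS1) weight `[v ∈ R]`. -/
def wPS1 : Bool → Bool → R := fun a _ => if a then 1 else 0

/-- The (PS) weight `[v ∈ R] ≠ [v ∈ B]` (the class `S_D`). -/
def wXOR : Bool → Bool → R := fun a b => if a ≠ b then 1 else 0

/-- The weight «`v` in neither cluster» (the class `S_N`). -/
def wNEITHER : Bool → Bool → R := fun a b => if (!a && !b) then 1 else 0

/-- The weight «`v` in both clusters» (the class `S_K`). -/
def wBOTH : Bool → Bool → R := fun a b => if (a && b) then 1 else 0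

omit [Fintype E] [DecidableEq E] in
/-- The (PS1) weight is the weight of `typedCount`. -/
lemma wtW_wPS1 (ends : E → Sym2 V) (s v : V) (ω ωb : Config E) :
    wtW (wPS1 : Bool → Bool → R) ends s v ω ωb = wt ends s v ω := by
  unfold wtW wPS1 wt
  by_cases h : v ∈ cluster ends ω s <;> simp [h]

/-- `typedCount` is the class count with the (PS1) weight. -/
theorem typedCount_eq_typedCountW (ends : E → Sym2 V) (s v : V) (F G : Set V → R)
    (S C : Finset E) :
    typedCount ends s v F G S C = typedCountW wPS1 ends s v F G S C := by
  unfold typedCount typedCountW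
  refine Finset.sum_congr rfl fun ω _ => ?_
  rw [wtW_wPS1]

/-- The class weights are nonnegative. -/
lemma wPS1_nonneg [PartialOrder R] [IsOrderedRing R] (a b : Bool) : (0 : R) ≤ wPS1 a b := by
  unfold wPS1; split_ifs <;> norm_num

/-- The class weights are nonnegative. -/
lemma wXOR_nonneg [PartialOrder R] [IsOrderedRing R] (a b : Bool) : (0 : R) ≤ wXOR a b := by
  unfold wXOR; split_ifs <;> norm_num

/-- The class weights are nonnegative. -/
lemma wNEITHER_nonneg [PartialOrder R] [IsOrderedRing R] (a b : Bool) : (0 : R) ≤ wNEITHER a b := by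
  unfold wNEITHER; split_ifs <;> norm_num

/-- The class weights are nonnegative. -/
lemma wBOTH_nonneg [PartialOrder R] [IsOrderedRing R] (a b : Bool) : (0 : R) ≤ wBOTH a b := by
  unfold wBOTH; split_ifs <;> norm_num

end DefsW

section MainW

open Classical

variable [Fintype E] [DecidableEq E] {R : Type*} [Field R] [LinearOrder R] [IsStrictOrderedRing R]

omit [Fintype E] [Field R] [LinearOrder R] [IsStrictOrderedRing R] in
/-- Across a pendant block the class weight of `ω₁ ⊔ ω₂` is the class weight of `ω₁`
(for the red and the blue cluster). -/
lemma wtW_join_pendant (W : Bool → Bool → R) (ends : E → Sym2 V) {V₁ : Set V} {s u v : V}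
    (hs : s ∈ V₁) (hu : u ∈ V₁) (hv : v ∈ V₁) {S₁ S₂ : Finset E} (hd : Disjoint S₁ S₂)
    (h₁ : ∀ e ∈ S₁, ∀ x ∈ ends e, x ∈ V₁) (h₂ : ∀ e ∈ S₂, ∀ x ∈ ends e, x ∉ V₁ ∨ x = u)
    {ω₁ ω₂ : Config E} (hω₁ : OnS S₁ ω₁) (hω₂ : OnS S₂ ω₂) :
    wtW W ends s v (join ω₁ ω₂) (flipOn (S₁ ∪ S₂) (join ω₁ ω₂)) =
      wtW W ends s v ω₁ (flipOn S₁ ω₁) := by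
  unfold wtW
  rw [flipOn_union_join hd hω₁ hω₂]
  have hr := mem_cluster_join_pendant_iff hs hu hv h₁ h₂ hω₁ hω₂
  have hb := mem_cluster_join_pendant_iff hs hu hv h₁ h₂ (onS_flipOn S₁ ω₁) (onS_flipOn S₂ ω₂)
  rw [decide_eq_decide.2 hr, decide_eq_decide.2 hb]

/-- **The pendant-block reduction for every nonnegative class weight**:
`2^{|S₂|} · T_W(S₁; F̂, Ĝ) ≤ T_W(S₁ ⊔ S₂; F, G)`. -/
theorem typedCountW_pendant_reduction (W : Bool → Bool → R) (hW : ∀ a b, 0 ≤ W a b)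
    (ends : E → Sym2 V) {V₁ : Set V} {s u v : V} (hs : s ∈ V₁) (hu : u ∈ V₁) (hv : v ∈ V₁)
    {S₁ S₂ : Finset E} (hd : Disjoint S₁ S₂)
    (h₁ : ∀ e ∈ S₁, ∀ x ∈ ends e, x ∈ V₁) (h₂ : ∀ e ∈ S₂, ∀ x ∈ ends e, x ∉ V₁ ∨ x = u)
    {F G : Set V → R} (hF : Monotone F) (hG : Monotone G) :
    (2 : R) ^ S₂.card * typedCountW W ends s v (hat ends u S₂ F) (hat ends u S₂ G) S₁ ∅ ≤
      typedCountW W ends s v F G (S₁ ∪ S₂) ∅ := by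
  unfold typedCountW
  simp only [withC_empty]
  have hsum := sum_onS_union hd (fun ω => wtW W ends s v ω (flipOn (S₁ ∪ S₂) ω) *
    dlt F G (cluster ends ω s) (cluster ends (flipOn (S₁ ∪ S₂) ω) s))
  rw [hsum, Finset.mul_sum]
  refine Finset.sum_le_sum fun ω₁ _ => ?_
  split_ifs with hω₁
  · have hY₁ : OnS S₁ (flipOn S₁ ω₁) := onS_flipOn S₁ ω₁
    have hw : (0 : R) ≤ wtW W ends s v ω₁ (flipOn S₁ ω₁) := hW _ _
    have inner : ∀ ω₂ : Config E, (if OnS S₂ ω₂ then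
        wtW W ends s v (join ω₁ ω₂) (flipOn (S₁ ∪ S₂) (join ω₁ ω₂)) *
        dlt F G (cluster ends (join ω₁ ω₂) s)
          (cluster ends (flipOn (S₁ ∪ S₂) (join ω₁ ω₂)) s) else 0) =
        wtW W ends s v ω₁ (flipOn S₁ ω₁) * (if OnS S₂ ω₂ then
          (F (cluster ends ω₁ s ∪
                (if u ∈ cluster ends ω₁ s then cluster ends ω₂ u else ∅)) -
              F (cluster ends (flipOn S₁ ω₁) s ∪
                (if u ∈ cluster ends (flipOn S₁ ω₁) s then cluster ends (flipOn S₂ ω₂) u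
                  else ∅))) *
            (G (cluster ends ω₁ s ∪
                (if u ∈ cluster ends ω₁ s then cluster ends ω₂ u else ∅)) -
              G (cluster ends (flipOn S₁ ω₁) s ∪
                (if u ∈ cluster ends (flipOn S₁ ω₁) s then cluster ends (flipOn S₂ ω₂) u
                  else ∅))) else 0) := by
      intro ω₂
      by_cases hω₂ : OnS S₂ ω₂
      · rw [if_pos hω₂, if_pos hω₂, wtW_join_pendant W ends hs hu hv hd h₁ h₂ hω₁ hω₂,
          flipOn_union_join hd hω₁ hω₂, cluster_join_pendant hs hu h₁ h₂ hω₁ hω₂,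
          cluster_join_pendant hs hu h₁ h₂ hY₁ (onS_flipOn S₂ ω₂)]
        rfl
      · rw [if_neg hω₂, if_neg hω₂, mul_zero]
    simp_rw [inner]
    rw [← Finset.mul_sum]
    have hin := inner_pendant_ge ends u S₂ hF hG (cluster ends ω₁ s)
      (cluster ends (flipOn S₁ ω₁) s)
    calc (2 : R) ^ S₂.card * (wtW W ends s v ω₁ (flipOn S₁ ω₁) *
          dlt (hat ends u S₂ F) (hat ends u S₂ G) (cluster ends ω₁ s)
            (cluster ends (flipOn S₁ ω₁) s))
        = wtW W ends s v ω₁ (flipOn S₁ ω₁) * ((2 : R) ^ S₂.card *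
          dlt (hat ends u S₂ F) (hat ends u S₂ G) (cluster ends ω₁ s)
            (cluster ends (flipOn S₁ ω₁) s)) := by ring
      _ ≤ _ := mul_le_mul_of_nonneg_left hin hw
  · simp

/-- **Positivity of every class count transfers across a pendant block.** -/
theorem typedCountW_nonneg_of_pendant (W : Bool → Bool → R) (hW : ∀ a b, 0 ≤ W a b)
    (ends : E → Sym2 V) {V₁ : Set V} {s u v : V} (hs : s ∈ V₁) (hu : u ∈ V₁) (hv : v ∈ V₁)
    {S₁ S₂ : Finset E} (hd : Disjoint S₁ S₂)
    (h₁ : ∀ e ∈ S₁, ∀ x ∈ ends e, x ∈ V₁) (h₂ : ∀ e ∈ S₂, ∀ x ∈ ends e, x ∉ V₁ ∨ x = u)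
    {F G : Set V → R} (hF : Monotone F) (hG : Monotone G)
    (hred : 0 ≤ typedCountW W ends s v (hat ends u S₂ F) (hat ends u S₂ G) S₁ ∅) :
    0 ≤ typedCountW W ends s v F G (S₁ ∪ S₂) ∅ :=
  le_trans (mul_nonneg (by positivity) hred)
    (typedCountW_pendant_reduction W hW ends hs hu hv hd h₁ h₂ hF hG)

/-- The typed (PS) count `S_D` inherits positivity across a pendant block. -/
theorem typedCountXOR_nonneg_of_pendant (ends : E → Sym2 V) {V₁ : Set V} {s u v : V}
    (hs : s ∈ V₁) (hu : u ∈ V₁) (hv : v ∈ V₁) {S₁ S₂ : Finset E} (hd : Disjoint S₁ S₂)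
    (h₁ : ∀ e ∈ S₁, ∀ x ∈ ends e, x ∈ V₁) (h₂ : ∀ e ∈ S₂, ∀ x ∈ ends e, x ∉ V₁ ∨ x = u)
    {F G : Set V → R} (hF : Monotone F) (hG : Monotone G)
    (hred : 0 ≤ typedCountW wXOR ends s v (hat ends u S₂ F) (hat ends u S₂ G) S₁ ∅) :
    0 ≤ typedCountW wXOR ends s v F G (S₁ ∪ S₂) ∅ :=
  typedCountW_nonneg_of_pendant wXOR wXOR_nonneg ends hs hu hv hd h₁ h₂ hF hG hred

end MainW

end TypedDeletion

end Summit.Ventures.PercRepro2
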